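import Summits.HubbardSuperconductivity.HubbardSuperconductivity.Theorems.CooperPairDMottWalkPlaquetteTables
import Summits.HubbardSuperconductivity.HubbardSuperconductivity.Theorems.CooperPairDMottWalkPlaquetteCertData
import Summits.HubbardSuperconductivity.HubbardSuperconductivity.Theorems.CooperPairDMottWalkPlaquetteGramCert
import Literature.MathematicalPhysics.QuantumLattice.HubbardSzSectorLadder

/-!
# Route `CooperPairDMottWalk`, crux `CooperPairDMott`: the plaquette pair-binding inequality

Stub `stub_plaquettePairBinding` of the line `Cruxes/CooperPairDMott/Lines/birth.lean`
(item stmt-HubbardSuperconductivity-1177; verbatim clause 1 of the support item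
`PlaquettePairBinding`, stmt-HubbardSuperconductivity-1181): for every `U ∈ [2, 4]` the isolated
`2 × 2` Hubbard plaquette `hubbardTorus 2 2 1 U = plaquetteHamiltonian U` (the 4-cycle with hopping
`1`) binds a pair, `e₂⁰(U) + e₄⁰(U) < 2 e₃^½(U)` with `e_N^M(U) = minEnergyOn (szSector N M)`
(Tsai–Kivelson 2006: `Δ_p(U) = 2e₃ − e₂ − e₄ > 0` iff `0 < U < U_c ≈ 4.58`; numerically
`Δ_p = 0.037 / 0.039 / 0.036 / 0.029 / 0.017` at `U = 2, 5/2, 3, 7/2, 4`).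

Proof (certified exact diagonalisation; only kernel-checked integer arithmetic is trusted):
* everything is transported to the computable `Fin 4` model `ham4 U` of `…PlaquetteModel`
  (`plaquetteHamiltonian U = Γ ham4(U) Γᴴ`) and written in Lieb's sector coordinates of
  `…PlaquetteTables` (`Re ⟨ψ, Hψ⟩ = hopForm + U · dblForm`, affine in `U`);
* `minEnergyOn_two_le`, `minEnergyOn_four_le`: variational UPPER bounds on `e₂⁰ = min (1,1)`,
  `e₄⁰ = min (2,2)` by the integer trial arrays `v2_k`, `v4_k` of `…PlaquetteCertData` (rounded
  sector ground states at the midpoints of `[2, 5/2], …, [7/2, 4]`), their integers `hopZ`, `dblZ`,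
  `nsqZ` evaluated by `decide` (`upDownSector_groundState` + `expect_push`);
* `le_minEnergyOn_three`: a LOWER bound on `e₃^½ = min (2,1)` is a lower bound of the real
  `24`-dimensional sector form (ground state pulled back along `Γᴴ`, `eigen_pull`); at the grid
  points `U_j = 2 + j/2` the form bound `m_j/1000` (`m_j = -3211, -3071, -2950, -2845, -2754`;
  numerically `e₃(U_j) = -3.2093, -3.0696, -2.9485, -2.8435, -2.7522`) is certified by the Gram /
  diagonal-dominance check `ddCheckP` of `…PlaquetteGramCert` on the data `gCert21_j`, evaluated
  by `decide` (`form21_lb_j`); the form is affine in `U`, so chords are lower bounds in between;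
* on each interval the resulting affine inequality in `U` holds at both endpoints (`linarith`);
  the smallest margin is `0.0106` at `U = 4`.

Sources: W.-F. Tsai, S. A. Kivelson, PRB 73 (2006) 214510, eq. (2) and Fig. 1; E. H. Lieb, PRL 62
(1989) 1201, eq. (4).
-/

set_option linter.dupNamespace false

noncomputable section

namespace Summit.HubbardSuperconductivity.HubbardSuperconductivity.Theorems.CooperPairDMottWalk

open Literature.MathematicalPhysics.QuantumLattice Literature.MathematicalPhysics.QuantumLattice.TwoSpecies
open Matrix Finset
open scoped ComplexOrder

/-! ### Transport to the plaquette: variational upper bounds and the certified lower bound -/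

/-- `1 ≤ |PlaquetteSite| = 4`. [folklore] -/
private theorem one_le_card_plaquetteSite : 1 ≤ Fintype.card PlaquetteSite := by
  rw [card_plaquetteSite]; omega

/-- `2 ≤ |PlaquetteSite| = 4`. [folklore] -/
private theorem two_le_card_plaquetteSite : 2 ≤ Fintype.card PlaquetteSite := by
  rw [card_plaquetteSite]; omega

/-- **Upper bound on `e₂⁰`** by an integer trial array in the sector `(1,1)` of the `Fin 4`
model (variational principle, transported along `Γ`). [folklore] -/
theorem minEnergyOn_two_le (U : ℝ) (v : Fin 4 → Fin 4 → ℤ) (hv : 0 < nsqZ v) :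
    (plaquetteHamiltonian U).minEnergyOn (szSector 2 0) ≤
      (hopZ K1 K1 v + U * dblZ d11 v) / nsqZ v := by
  set ψ : Fock (Orb (Fin 4)) := ofSectorArray s1 s1 (fun i j => ((v i j : ℤ) : ℂ)) with hψdef
  have hψ : IsInSector 1 1 ψ := isInSector_ofSectorArray isSubsetEnum_s1 isSubsetEnum_s1 _
  have hw : w11 ψ = fun i j => ((v i j : ℤ) : ℂ) :=
    funext fun i => funext fun j => coeffMatrix_ofSectorArray isSubsetEnum_s1 isSubsetEnum_s1 _ i j
  obtain ⟨hn, hH⟩ := sector11_forms U hψ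
  rw [hw, normSqW_intCast] at hn
  rw [hw, hopForm_intCast, dblForm_intCast] at hH
  have hχ : IsInSector 1 1 (gam *ᵥ ψ) := isInSector_relabelMatrix_mulVec siteEquiv hψ
  obtain ⟨hexp, hnorm⟩ := expect_push U ψ
  have hbd := (upDownSector_groundState plaquetteGraph 1 U one_le_card_plaquetteSite
    one_le_card_plaquetteSite).2 (gam *ᵥ ψ) hχ
  have hs : (szSector (1 + 1) ((((1 : ℕ) : ℝ) - ((1 : ℕ) : ℝ)) / 2) :
      Submodule ℂ (Fock (Orb PlaquetteSite))) = szSector 2 0 := by norm_num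
  rw [hs, Literature.MathematicalPhysics.QuantumLattice.expect,
    show hamiltonian plaquetteGraph 1 U = plaquetteHamiltonian U from rfl, hexp, hnorm, hn, hH] at hbd
  rw [le_div_iff₀ (by exact_mod_cast hv)]
  simpa using hbd

/-- **Upper bound on `e₄⁰`** by an integer trial array in the sector `(2,2)`. [folklore] -/
theorem minEnergyOn_four_le (U : ℝ) (v : Fin 6 → Fin 6 → ℤ) (hv : 0 < nsqZ v) :
    (plaquetteHamiltonian U).minEnergyOn (szSector 4 0) ≤
      (hopZ K2 K2 v + U * dblZ d22 v) / nsqZ v := by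
  set ψ : Fock (Orb (Fin 4)) := ofSectorArray s2 s2 (fun i j => ((v i j : ℤ) : ℂ)) with hψdef
  have hψ : IsInSector 2 2 ψ := isInSector_ofSectorArray isSubsetEnum_s2 isSubsetEnum_s2 _
  have hw : w22 ψ = fun i j => ((v i j : ℤ) : ℂ) :=
    funext fun i => funext fun j => coeffMatrix_ofSectorArray isSubsetEnum_s2 isSubsetEnum_s2 _ i j
  obtain ⟨hn, hH⟩ := sector22_forms U hψ
  rw [hw, normSqW_intCast] at hn
  rw [hw, hopForm_intCast, dblForm_intCast] at hH
  have hχ : IsInSector 2 2 (gam *ᵥ ψ) := isInSector_relabelMatrix_mulVec siteEquiv hψ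
  obtain ⟨hexp, hnorm⟩ := expect_push U ψ
  have hbd := (upDownSector_groundState plaquetteGraph 1 U two_le_card_plaquetteSite
    two_le_card_plaquetteSite).2 (gam *ᵥ ψ) hχ
  have hs : (szSector (2 + 2) ((((2 : ℕ) : ℝ) - ((2 : ℕ) : ℝ)) / 2) :
      Submodule ℂ (Fock (Orb PlaquetteSite))) = szSector 4 0 := by norm_num
  rw [hs, Literature.MathematicalPhysics.QuantumLattice.expect,
    show hamiltonian plaquetteGraph 1 U = plaquetteHamiltonian U from rfl, hexp, hnorm, hn, hH] at hbd
  rw [le_div_iff₀ (by exact_mod_cast hv)]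
  simpa using hbd

/-- **Lower bound on `e₃^½`** from a lower bound of the real sector form `(2,1)` of the `Fin 4`
model: a sector ground state exists (`upDownSector_groundState`), is pulled back along `Γᴴ`
(`eigen_pull`), and its Rayleigh quotient is the sector energy. [folklore] -/
theorem le_minEnergyOn_three (U lam : ℝ)
    (h : ∀ x : Fin 6 → Fin 4 → ℝ, lam * nsqR x ≤ hopR K2 K1 x + U * dblR d21 x) :
    lam ≤ (plaquetteHamiltonian U).minEnergyOn (szSector 3 (1 / 2)) := by
  obtain ⟨⟨χ, hχ, hχ0, hHχ⟩, -⟩ := upDownSector_groundState plaquetteGraph 1 U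
    two_le_card_plaquetteSite one_le_card_plaquetteSite
  have hs : (szSector (2 + 1) ((((2 : ℕ) : ℝ) - ((1 : ℕ) : ℝ)) / 2) :
      Submodule ℂ (Fock (Orb PlaquetteSite))) = szSector 3 (1 / 2) := by norm_num
  rw [hs, show hamiltonian plaquetteGraph 1 U = plaquetteHamiltonian U from rfl] at hHχ
  set e := (plaquetteHamiltonian U).minEnergyOn (szSector 3 (1 / 2)) with he
  obtain ⟨hH4, hnorm⟩ := eigen_pull U hHχ
  set ψ := gamᴴ *ᵥ χ with hψdef
  have hψ : IsInSector 2 1 ψ := isInSector_conjTranspose_relabelMatrix_mulVec siteEquiv hχ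
  have hψ0 : ψ ≠ 0 := fun h0 =>
    hχ0 ((conjTranspose_relabelMatrix_mulVec_eq_zero_iff orbEquiv χ).1 h0)
  obtain ⟨hn, hH⟩ := sector21_forms U hψ
  have hval : (star ψ ⬝ᵥ (ham4 U *ᵥ ψ)).re = e * (star ψ ⬝ᵥ ψ).re := by
    rw [hH4, dotProduct_smul, smul_eq_mul, Complex.re_ofReal_mul]
  have hpos : 0 < (star ψ ⬝ᵥ ψ).re := by
    have hp : 0 < star ψ ⬝ᵥ ψ := dotProduct_star_self_pos_iff.2 hψ0
    exact (Complex.pos_iff.mp hp).1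
  rw [hn] at hpos hval
  rw [hH, normSqW_eq_nsqR, hopForm_eq_hopR, dblForm_eq_dblR] at hval
  rw [normSqW_eq_nsqR] at hpos
  have h1 := h (fun i j => (w21 ψ i j).re)
  have h2 := h (fun i j => (w21 ψ i j).im)
  have key : lam * (nsqR (fun i j => (w21 ψ i j).re) + nsqR (fun i j => (w21 ψ i j).im)) ≤
      e * (nsqR (fun i j => (w21 ψ i j).re) + nsqR (fun i j => (w21 ψ i j).im)) := by linarith
  exact le_of_mul_le_mul_right key hpos

/-! ### Kernel-checked certificates: lower bounds of the sector-`(2,1)` form on the grid -/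

/-- Certified lower bound of the sector-`(2,1)` form at `U = 2`:
`(-3211/1000) ‖x‖² ≤ hopR x + U · dblR x` (the check `ddCheckP` of the Gram data `gCert21_0`,
scale `2^20`, is evaluated by the kernel). [folklore] -/
theorem form21_lb_0 (x : Fin 6 → Fin 4 → ℝ) :
    (-3211 / 1000 : ℝ) * nsqR x ≤ hopR K2 K1 x + 2 * dblR d21 x := by
  have h := form_lowerBound_of_ddCheckP K2 K1 d21 1000 2000 (-3211)
    (fun a b : Fin 6 × Fin 4 => gCert21_0 a.1 a.2 b.1 b.2) (s := 2 ^ 20) (by norm_num)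
    (by decide +kernel) x
  push_cast at h
  linarith

/-- Certified lower bound of the sector-`(2,1)` form at `U = 5 / 2`:
`(-3071/1000) ‖x‖² ≤ hopR x + U · dblR x` (the check `ddCheckP` of the Gram data `gCert21_1`,
scale `2^21`, is evaluated by the kernel). [folklore] -/
theorem form21_lb_1 (x : Fin 6 → Fin 4 → ℝ) :
    (-3071 / 1000 : ℝ) * nsqR x ≤ hopR K2 K1 x + 5 / 2 * dblR d21 x := by
  have h := form_lowerBound_of_ddCheckP K2 K1 d21 1000 2500 (-3071)
    (fun a b : Fin 6 × Fin 4 => gCert21_1 a.1 a.2 b.1 b.2) (s := 2 ^ 21) (by norm_num)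
    (by decide +kernel) x
  push_cast at h
  linarith

/-- Certified lower bound of the sector-`(2,1)` form at `U = 3`:
`(-2950/1000) ‖x‖² ≤ hopR x + U · dblR x` (the check `ddCheckP` of the Gram data `gCert21_2`,
scale `2^21`, is evaluated by the kernel). [folklore] -/
theorem form21_lb_2 (x : Fin 6 → Fin 4 → ℝ) :
    (-2950 / 1000 : ℝ) * nsqR x ≤ hopR K2 K1 x + 3 * dblR d21 x := by
  have h := form_lowerBound_of_ddCheckP K2 K1 d21 1000 3000 (-2950)
    (fun a b : Fin 6 × Fin 4 => gCert21_2 a.1 a.2 b.1 b.2) (s := 2 ^ 21) (by norm_num)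
    (by decide +kernel) x
  push_cast at h
  linarith

/-- Certified lower bound of the sector-`(2,1)` form at `U = 7 / 2`:
`(-2845/1000) ‖x‖² ≤ hopR x + U · dblR x` (the check `ddCheckP` of the Gram data `gCert21_3`,
scale `2^21`, is evaluated by the kernel). [folklore] -/
theorem form21_lb_3 (x : Fin 6 → Fin 4 → ℝ) :
    (-2845 / 1000 : ℝ) * nsqR x ≤ hopR K2 K1 x + 7 / 2 * dblR d21 x := by
  have h := form_lowerBound_of_ddCheckP K2 K1 d21 1000 3500 (-2845)
    (fun a b : Fin 6 × Fin 4 => gCert21_3 a.1 a.2 b.1 b.2) (s := 2 ^ 21) (by norm_num)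
    (by decide +kernel) x
  push_cast at h
  linarith

/-- Certified lower bound of the sector-`(2,1)` form at `U = 4`:
`(-2754/1000) ‖x‖² ≤ hopR x + U · dblR x` (the check `ddCheckP` of the Gram data `gCert21_4`,
scale `2^21`, is evaluated by the kernel). [folklore] -/
theorem form21_lb_4 (x : Fin 6 → Fin 4 → ℝ) :
    (-2754 / 1000 : ℝ) * nsqR x ≤ hopR K2 K1 x + 4 * dblR d21 x := by
  have h := form_lowerBound_of_ddCheckP K2 K1 d21 1000 4000 (-2754)
    (fun a b : Fin 6 × Fin 4 => gCert21_4 a.1 a.2 b.1 b.2) (s := 2 ^ 21) (by norm_num)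
    (by decide +kernel) x
  push_cast at h
  linarith

/-! ### Variational upper bounds from the trial arrays of `…PlaquetteCertData` -/

/-- Upper bound on `e₂⁰(U)` from `v2_0` (its integers `hopZ, dblZ, nsqZ` by `decide`). [folklore] -/
theorem e2_le_0 (U : ℝ) :
    (plaquetteHamiltonian U).minEnergyOn (szSector 2 0) ≤ (-387846368 + U * 12630916) / 99994588 := by
  have e : hopZ K1 K1 v2_0 = -387846368 ∧ dblZ d11 v2_0 = 12630916 ∧ nsqZ v2_0 = 99994588 := by
    decide +kernel
  have h := minEnergyOn_two_le U v2_0 (by rw [e.2.2]; decide)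
  rw [e.1, e.2.1, e.2.2] at h
  push_cast at h
  linarith

/-- Upper bound on `e₄⁰(U)` from `v4_0` (its integers `hopZ, dblZ, nsqZ` by `decide`). [folklore] -/
theorem e4_le_0 (U : ℝ) :
    (plaquetteHamiltonian U).minEnergyOn (szSector 4 0) ≤ (-367862976 + U * 42700248) / 99979286 := by
  have e : hopZ K2 K2 v4_0 = -367862976 ∧ dblZ d22 v4_0 = 42700248 ∧ nsqZ v4_0 = 99979286 := by
    decide +kernel
  have h := minEnergyOn_four_le U v4_0 (by rw [e.2.2]; decide)
  rw [e.1, e.2.1, e.2.2] at h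
  push_cast at h
  linarith

/-- Upper bound on `e₂⁰(U)` from `v2_1` (its integers `hopZ, dblZ, nsqZ` by `decide`). [folklore] -/
theorem e2_le_1 (U : ℝ) :
    (plaquetteHamiltonian U).minEnergyOn (szSector 2 0) ≤ (-383872800 + U * 10995856) / 100023292 := by
  have e : hopZ K1 K1 v2_1 = -383872800 ∧ dblZ d11 v2_1 = 10995856 ∧ nsqZ v2_1 = 100023292 := by
    decide +kernel
  have h := minEnergyOn_two_le U v2_1 (by rw [e.2.2]; decide)
  rw [e.1, e.2.1, e.2.2] at h
  push_cast at h
  linarith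

/-- Upper bound on `e₄⁰(U)` from `v4_1` (its integers `hopZ, dblZ, nsqZ` by `decide`). [folklore] -/
theorem e4_le_1 (U : ℝ) :
    (plaquetteHamiltonian U).minEnergyOn (szSector 4 0) ≤ (-356264896 + U * 38030856) / 99998522 := by
  have e : hopZ K2 K2 v4_1 = -356264896 ∧ dblZ d22 v4_1 = 38030856 ∧ nsqZ v4_1 = 99998522 := by
    decide +kernel
  have h := minEnergyOn_four_le U v4_1 (by rw [e.2.2]; decide)
  rw [e.1, e.2.1, e.2.2] at h
  push_cast at h
  linarith

/-- Upper bound on `e₂⁰(U)` from `v2_2` (its integers `hopZ, dblZ, nsqZ` by `decide`). [folklore] -/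
theorem e2_le_2 (U : ℝ) :
    (plaquetteHamiltonian U).minEnergyOn (szSector 2 0) ≤ (-379681920 + U * 9610000) / 100010864 := by
  have e : hopZ K1 K1 v2_2 = -379681920 ∧ dblZ d11 v2_2 = 9610000 ∧ nsqZ v2_2 = 100010864 := by
    decide +kernel
  have h := minEnergyOn_two_le U v2_2 (by rw [e.2.2]; decide)
  rw [e.1, e.2.1, e.2.2] at h
  push_cast at h
  linarith

/-- Upper bound on `e₄⁰(U)` from `v4_2` (its integers `hopZ, dblZ, nsqZ` by `decide`). [folklore] -/
theorem e4_le_2 (U : ℝ) :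
    (plaquetteHamiltonian U).minEnergyOn (szSector 4 0) ≤ (-343976000 + U * 33935376) / 99988352 := by
  have e : hopZ K2 K2 v4_2 = -343976000 ∧ dblZ d22 v4_2 = 33935376 ∧ nsqZ v4_2 = 99988352 := by
    decide +kernel
  have h := minEnergyOn_four_le U v4_2 (by rw [e.2.2]; decide)
  rw [e.1, e.2.1, e.2.2] at h
  push_cast at h
  linarith

/-- Upper bound on `e₂⁰(U)` from `v2_3` (its integers `hopZ, dblZ, nsqZ` by `decide`). [folklore] -/
theorem e2_le_3 (U : ℝ) :
    (plaquetteHamiltonian U).minEnergyOn (szSector 2 0) ≤ (-375686688 + U * 8456464) / 100020700 := by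
  have e : hopZ K1 K1 v2_3 = -375686688 ∧ dblZ d11 v2_3 = 8456464 ∧ nsqZ v2_3 = 100020700 := by
    decide +kernel
  have h := minEnergyOn_two_le U v2_3 (by rw [e.2.2]; decide)
  rw [e.1, e.2.1, e.2.2] at h
  push_cast at h
  linarith

/-- Upper bound on `e₄⁰(U)` from `v4_3` (its integers `hopZ, dblZ, nsqZ` by `decide`). [folklore] -/
theorem e4_le_3 (U : ℝ) :
    (plaquetteHamiltonian U).minEnergyOn (szSector 4 0) ≤ (-331494144 + U * 30356616) / 99999142 := by
  have e : hopZ K2 K2 v4_3 = -331494144 ∧ dblZ d22 v4_3 = 30356616 ∧ nsqZ v4_3 = 99999142 := by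
    decide +kernel
  have h := minEnergyOn_four_le U v4_3 (by rw [e.2.2]; decide)
  rw [e.1, e.2.1, e.2.2] at h
  push_cast at h
  linarith

/-! ### Chord lower bounds on `e₃^½` and the stub -/

/-- Chord lower bound on `e₃^½(U)` on `[2, 5 / 2]` (the sector form is affine in `U`). [folklore] -/
theorem e3_ge_0 (U : ℝ) (ha : 2 ≤ U) (hb : U ≤ 5 / 2) :
    2 * ((5 / 2 - U) * (-3211 / 1000) + (U - 2) * (-3071 / 1000)) ≤
      (plaquetteHamiltonian U).minEnergyOn (szSector 3 (1 / 2)) := by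
  refine le_minEnergyOn_three U _ fun x => ?_
  have c0 := mul_le_mul_of_nonneg_left (form21_lb_0 x) (by linarith : (0 : ℝ) ≤ 2 * (5 / 2 - U))
  have c1 := mul_le_mul_of_nonneg_left (form21_lb_1 x) (by linarith : (0 : ℝ) ≤ 2 * (U - 2))
  linarith

/-- Chord lower bound on `e₃^½(U)` on `[5 / 2, 3]` (the sector form is affine in `U`). [folklore] -/
theorem e3_ge_1 (U : ℝ) (ha : 5 / 2 ≤ U) (hb : U ≤ 3) :
    2 * ((3 - U) * (-3071 / 1000) + (U - 5 / 2) * (-2950 / 1000)) ≤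
      (plaquetteHamiltonian U).minEnergyOn (szSector 3 (1 / 2)) := by
  refine le_minEnergyOn_three U _ fun x => ?_
  have c0 := mul_le_mul_of_nonneg_left (form21_lb_1 x) (by linarith : (0 : ℝ) ≤ 2 * (3 - U))
  have c1 := mul_le_mul_of_nonneg_left (form21_lb_2 x) (by linarith : (0 : ℝ) ≤ 2 * (U - 5 / 2))
  linarith

/-- Chord lower bound on `e₃^½(U)` on `[3, 7 / 2]` (the sector form is affine in `U`). [folklore] -/
theorem e3_ge_2 (U : ℝ) (ha : 3 ≤ U) (hb : U ≤ 7 / 2) :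
    2 * ((7 / 2 - U) * (-2950 / 1000) + (U - 3) * (-2845 / 1000)) ≤
      (plaquetteHamiltonian U).minEnergyOn (szSector 3 (1 / 2)) := by
  refine le_minEnergyOn_three U _ fun x => ?_
  have c0 := mul_le_mul_of_nonneg_left (form21_lb_2 x) (by linarith : (0 : ℝ) ≤ 2 * (7 / 2 - U))
  have c1 := mul_le_mul_of_nonneg_left (form21_lb_3 x) (by linarith : (0 : ℝ) ≤ 2 * (U - 3))
  linarith

/-- Chord lower bound on `e₃^½(U)` on `[7 / 2, 4]` (the sector form is affine in `U`). [folklore] -/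
theorem e3_ge_3 (U : ℝ) (ha : 7 / 2 ≤ U) (hb : U ≤ 4) :
    2 * ((4 - U) * (-2845 / 1000) + (U - 7 / 2) * (-2754 / 1000)) ≤
      (plaquetteHamiltonian U).minEnergyOn (szSector 3 (1 / 2)) := by
  refine le_minEnergyOn_three U _ fun x => ?_
  have c0 := mul_le_mul_of_nonneg_left (form21_lb_3 x) (by linarith : (0 : ℝ) ≤ 2 * (4 - U))
  have c1 := mul_le_mul_of_nonneg_left (form21_lb_4 x) (by linarith : (0 : ℝ) ≤ 2 * (U - 7 / 2))
  linarith

/-- **Stub Δ of the line `CooperPairDMott/birth` — plaquette pair binding** (clause 1 of the support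
item `PlaquettePairBinding`): for every `U ∈ [2, 4]` the isolated `2 × 2` Hubbard plaquette
`hubbardTorus 2 2 1 U` satisfies `e₂⁰ + e₄⁰ < 2 e₃^½` (`e_N^M = minEnergyOn (szSector N M)`), i.e.
`Δ_p(U) = 2E₃ − E₂ − E₄ > 0`. Certified exact diagonalisation: variational upper bounds on `e₂⁰`,
`e₄⁰` from integer trial arrays and kernel-checked Gram certificates for the lower bound on `e₃^½`
on the grid `U = 2, 5/2, 3, 7/2, 4`, chords in between, endpoint checks per interval.
Tsai–Kivelson, PRB 73 (2006) 214510 (`Δ_p > 0` iff `0 < U < U_c ≈ 4.58`).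
[cite: TsaiKivelson2006, eq. (2) and Fig. 1] -/
theorem stub_plaquettePairBinding :
    ∀ U ∈ Set.Icc (2 : ℝ) 4,
      (hubbardTorus 2 2 1 U).minEnergyOn (szSector 2 0) +
          (hubbardTorus 2 2 1 U).minEnergyOn (szSector 4 0) <
        2 * (hubbardTorus 2 2 1 U).minEnergyOn (szSector 3 (1 / 2)) := by
  intro U hU
  rw [← plaquetteHamiltonian_eq_hubbardTorus]
  obtain ⟨hU2, hU4⟩ := hU
  rcases le_or_gt U (5 / 2) with hUa | hUa
  · linarith [e2_le_0 U, e4_le_0 U, e3_ge_0 U hU2 hUa]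
  rcases le_or_gt U 3 with hUb | hUb
  · linarith [e2_le_1 U, e4_le_1 U, e3_ge_1 U hUa.le hUb]
  rcases le_or_gt U (7 / 2) with hUc | hUc
  · linarith [e2_le_2 U, e4_le_2 U, e3_ge_2 U hUb.le hUc]
  · linarith [e2_le_3 U, e4_le_3 U, e3_ge_3 U hUc.le hU4]

end Summit.HubbardSuperconductivity.HubbardSuperconductivity.Theorems.CooperPairDMottWalk
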